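import Summits.QuantumFields.BalabanUV.Beta.D1BFx.KCombineCovColourTorus
import Summits.QuantumFields.BalabanUV.Beta.D1BFx.PackedSlotMultilinear
import Summits.QuantumFields.BalabanUV.Beta.D1BFx.PeriodicArrayPackingPlain

/-!
# `BalabanUV.Beta.D1BFx.PackedTowerSlots` — road «BF-x» for binder row D1, slot (K), chain step (I) «(A1)-PACKED», brick (B5) «GRAM-COV-PACKED» ∕
# «FP-PACKED-LIMIT», FILE 2 «TOWER-PACKED»: **ON EVERY COARSE TORUS THE TWO TOWER SLOTS OF `identity_array_currency_cov_What0_stripped` AT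
# RESPONSE-PACKED JETS ARE TORUS ONE-LOOP FUNCTIONALS OF PERIODISED ARRAYS OF EXPLICIT PACKED `ℤ⁴` WORD FAMILIES** — the «COMB-FP» slot against
# the identity leg with the packed comb words `Σ_κ wsum (w κ) (nFcol κ)` and, at second order, the bond-DIAGONAL packing with ONE weight PERIODISED;
# the «GRAM-COV» slot against the composite ghost leg with the packed ghost words `Σ_κ wsum (w κ) (Lgh κ)` and, at second order, the packed
# `L̂²`-pair word in PRODUCT form (FINDING F-g16-1 «WRAP»: the wrap-around is TA2's `arr` INSIDE the product, on every torus, no side condition)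

HONEST DEPENDENCY (cell records, verbatim): «continuum YM on T⁴ ⇐ BetaPertH ∧ nine spine estimates (0/9 proved); BetaPertH ⇐ (D1) ∧ (D4) ∧
CAP+tail; G-an2-4 gates asym, D1 and NE2/3/4.»  HONEST FRAMING (cell contract, verbatim): «discharging `BetaPertH` makes Bałaban's UV stability
UNCONDITIONAL — a real constructive-QFT result; it is NOT the continuum limit and NOT the Clay problem.»  THIS MODULE DISCHARGES NOTHING of (K),
of D1 or of the wall: [folklore] finite (bi)linear algebra and torus ∕ `ℤ⁴` array bookkeeping BY NAME over the road owner's «SLOT-PACK»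
(`PackedSlotMultilinear`), `KCombineCovColourTorus` §1–§2, `KGramCovJets`, `KCombineCovCombLeg`, this lineage's `CombFPWordArrays` ∕ `KCombineCovTowers`,
leaf-05's TB4-W 3b-gh (`TorusGhostWordArrays` ∕ `TorusGhostPairStencils` ∕ `TorusGhostPairArrays`) and FILE 1 `PeriodicArrayPackingPlain`.  DISPLAYED:
the ONE-SIDED WARD-L letters `hE•` of the literal's form jets against the packed gauge jets, and the PINNING of the packed gauge ∕ co-frame jets to THE
CONVENTION ∕ TB4-W at the torus' fine bonds («COFRAME-PACK» as hypotheses).  No definition, no `def … : Prop`, nothing cited, 0 sorry.  0 root-level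
binders of row D1 discharged; (K) NOT closed; NOT D1, NOT `BetaPertH`, NOT continuum, NOT Clay.

ABSOLUTE RULE (cell charter, verbatim): «No internally-minted statement may enter as a cited fact. Every hypothesis is either kernel-proved in this
package or a verbatim quotation of a PUBLISHED theorem with page reference. The manuscript(s) under audit are NOT citable for their own disputed
steps — they are the thing under adjudication; programme-internal (2001/route/tribunal) claims are never citable.»

SETTING (road owner d1-p2's `A1-PACKED-SPEC.md` v0.3.1∕v0.4 §8; torus `n = m+1`, period `p`, `s = (m+1)·p`, root `r ∈ box 4 (m+1)`; bond index
`k = (z̄, (ẑ, κ′)) : I 3 (m+1) p`, torus bond `e₁ (m+1) p k`, window representative `ŵ_k := windowMap s (torusBlockEquiv (m+1) p (z̄, ẑ))`; two decaying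
direction-indexed weight families `wₛ wₜ : Fin 4 → ℤ⁴ → ℝ` (on the road: the `ℋ`-columns `colH G₀ n μ ŷ₀`, `colH G₀ n ν ŷ_z`, (B4b)) and torus responses
`rₛ k = Σ'_m wₛ κ′_k (ŵ_k + s·m)`, `rₜ` (displayed as hypotheses `hrₛ hrₜ` on opaque `rₛ rₜ`, so that (B3)∕(B6) may pass the KKT-inverse columns and
(B4b) `response_inl_eq_tsum_colH_window`)).
* §1 helpers: `e₁_eq_siteOf`, `submatrix_sum_smul`, `submatrix_sum_sum_smul`, the comb-word facts `biLoc_nFcol_self`, `nFcol_imageShift`, and the `perT`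
  readings of FILE 1 (`sum_smul_perT_arr`, `sum_smul_perT_arr_per`).
* §2 **`hessT_combFP_packed_eq_arr`** — «FP-PACKED» per torus.
* The «GRAM-COV» slot (the packed `L̂²` words and **`hessT_tgramCov_packed_eq_arr`**) is FILE 2b `PackedTowerSlotsGram` (size limit).
Unit `b2b-balaban-beta-d1-formalise-leaf-03` (gen 22); road owner `b2b-balaban-beta-d1-p2`.
-/

noncomputable section

namespace Summit.QuantumFields.BalabanUV.Beta.D1BFx.PackedTowerSlots

open Matrix
open scoped BigOperators
open Literature.Probability.LatticeModels (TorusSite)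
open Literature.MathematicalPhysics.QuantumFieldTheory.Balaban1983to89
open Literature.MathematicalPhysics.QuantumFieldTheory.Balaban1983to89.Beta
open B12Sec2to5 (l1 l1_nonneg)
open ExpKernelCalculus (MKer BiLoc Decays comp shiftK Zl Zl_pos Zl_nonneg)
open AffineAveraging (box toSite unitVec)
open KKTFluctuationKernel (delta1)
open OneStepResolventKernel (wsum biLoc_wsum)
open KernelWard (biLoc_recentre biLoc_add)
open BalabanStepJetsSucc (biLoc_comp_right)
open Summit.QuantumFields.BalabanUV.Beta.AxialProjectorBlockMean (bmGaugeAt)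
open Summit.QuantumFields.BalabanUV.Beta.D1BFx.FibredPeriodisation (periodiseF)
open Summit.QuantumFields.BalabanUV.Beta.D1BFx.SortedReblocking (torusBlockEquiv imageShift_mul_eq_add)
open Summit.QuantumFields.BalabanUV.Beta.D1BFx.SortedEmbedding (e₁ e₁_apply)
open Summit.QuantumFields.BalabanUV.Beta.D1BFx.PeriodicArrays (arr toF decays_arr arr_imageShift)
open Summit.QuantumFields.BalabanUV.Beta.D1BFx.MixedVarPackedHess (hessT)
open Summit.QuantumFields.BalabanUV.Beta.D1BFx.GramWeightJets (gram₀ gram₁)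
open Summit.QuantumFields.BalabanUV.Beta.D1BFx.GramWeightJetsMixed (gramMix)
open Summit.QuantumFields.BalabanUV.Beta.D1BFx.GramWeightColourLift (tgram₁ tgramMix)
open Summit.QuantumFields.BalabanUV.Beta.D1BFx.TorusCombKKT (I J CombRows tauT Khat)
open Summit.QuantumFields.BalabanUV.Beta.D1BFx.TorusGaugeBasis (What0 Khat_mul_What0)
open Summit.QuantumFields.BalabanUV.Beta.D1BFx.TorusGaugeBasisMatrix (NhatF Nhat bmGaugeAt_shift shift_delta1)
open Summit.QuantumFields.BalabanUV.Beta.D1BFx.PeriodisedProjector (Lhat)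
open Summit.QuantumFields.BalabanUV.Beta.D1BFx.TorusCoframeJets (Djet Ljet Ljet₂ Ljet₁₁ Ljet₁₁_self Ljet₁₁_of_ne Tjet₀ Tjet₁ Tjet₁₁ Ajet₀ Ajet₁ Ajet₁₁)
open Summit.QuantumFields.BalabanUV.Beta.D1BFx.TorusWeightJetsCombFree (Lsq₁ Lsq₁₁)
open Summit.QuantumFields.BalabanUV.Beta.D1BFx.GhostStencil (ghCur biLoc_ghCur ghCur_translate l1_unitVec l1_zero)
open Summit.QuantumFields.BalabanUV.Beta.D1BFx.GaugeJetLocal (idK1)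
open Summit.QuantumFields.BalabanUV.Beta.D1BFx.KGhostLeg (Cgh)
open Summit.QuantumFields.BalabanUV.Beta.D1BFx.TorusGhostWordArrays (perT lapU Lgh Ljet_eq_perT perT_add perT_arr_mul_perT perT_mul_perT_arr
  summable_row_arr arr_add decays_lapU lapU_imageShift Lhat_eq_perT biLoc_Lgh Lgh_translate)
open Summit.QuantumFields.BalabanUV.Beta.D1BFx.TorusGhostPairStencils (gh₂ biLoc_gh₂ gh₂_translate perT_arr_mul_perT_arr)
open Summit.QuantumFields.BalabanUV.Beta.D1BFx.TorusGhostPairArrays (Ljet₂_eq_perT)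
open Summit.QuantumFields.BalabanUV.Beta.D1BFx.KCombineCovLegs (det_Tjet₀_mul_What0_ne_zero det_Ajet₀_Nhat_ne_zero)
open Summit.QuantumFields.BalabanUV.Beta.D1BFx.KGramCovJets (hessT_gramCov_B_eq_Gjet hessT_Gjet_eq_Cgh_Lsq)
open Summit.QuantumFields.BalabanUV.Beta.D1BFx.KCombineCovColourTorus (gram₀_add_of_wardL tgram₁_add_eq_of_wardL tgramMix_add_eq_of_wardL
  hessT_tgram_eq_gram)
open Summit.QuantumFields.BalabanUV.Beta.D1BFx.KCombineCovTowers (submatrix_fst_perT Lsq₁_fst_eq_arr)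
open Summit.QuantumFields.BalabanUV.Beta.D1BFx.CombFPWordArrays (nFcol nFcol_apply biLoc_nFcol NhatF_sub_mul_Djet_sub_eq_arr)
open Summit.QuantumFields.BalabanUV.Beta.D1BFx.KCombineCovCombLeg (hessT_combFP_What0_eq_idK1)
open Summit.QuantumFields.BalabanUV.Beta.D1BFx.PackedSlotMultilinear (hessT_packed hessT_tgram_packed tgram₁_packed tgramMix_packed)
open Summit.QuantumFields.BalabanUV.Beta.D1BFx.PeriodicArrayPackingPlain (periodiseF_toF_arr_dirsum_wsum periodiseF_toF_arr_dirsum_wsum_per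
  biLoc_dirsum_wsum biLoc_dirsum_wsum_per)

/-! ## §1 Helpers -/

section Helpers

variable (n p : ℕ) [NeZero n] [NeZero p]

/-- [folklore] The torus bond of index `k` is the torus image of its window representative: `e₁ n p k = (σ ŵ_k, κ′_k)` (`siteOf_windowMap`). -/
theorem e₁_eq_siteOf (k : I 3 n p) :
    e₁ n p k = (siteOf 4 (n * p) (windowMap 4 (n * p) (torusBlockEquiv n p (k.1, k.2.1))), k.2.2) := by
  obtain ⟨zbar, zhat, κ⟩ := k
  rw [e₁_apply, siteOf_windowMap]

omit [NeZero n] [NeZero p] in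
/-- [folklore] Re-indexing commutes with finite linear combinations of matrices. -/
theorem submatrix_sum_smul {ι α β γ ε : Type*} [Fintype ι] (c : ι → ℝ) (M : ι → Matrix α β ℝ) (f : γ → α) (g : ε → β) :
    (∑ k, c k • M k).submatrix f g = ∑ k, c k • (M k).submatrix f g := by
  ext i j
  simp only [Matrix.submatrix_apply, Matrix.sum_apply, Matrix.smul_apply]

omit [NeZero n] [NeZero p] in
/-- [folklore] … and with finite double combinations. -/
theorem submatrix_sum_sum_smul {ι α β γ ε : Type*} [Fintype ι] (c : ι → ι → ℝ) (M : ι → ι → Matrix α β ℝ) (f : γ → α) (g : ε → β) :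
    (∑ k, ∑ l, c k l • M k l).submatrix f g = ∑ k, ∑ l, c k l • (M k l).submatrix f g := by
  ext i j
  simp only [Matrix.submatrix_apply, Matrix.sum_apply, Matrix.smul_apply]

variable (r : Fin (3 + 1) → ℕ)

/-- [folklore] **THE COMB-FP WORDS ARE SELF-LOCALISED**: `BiLoc (nFcol κ u) u u (8n·e^{4nδ}·e^{δ}) δ` (`biLoc_nFcol` at `(u, u + e_κ)`, re-centred). -/
theorem biLoc_nFcol_self (hr : r ∈ box (3 + 1) n) {δ : ℝ} (hδ : 0 ≤ δ) (κ : Fin 4) (u : Fin 4 → ℤ) :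
    BiLoc (nFcol r n κ u) u u (2 * (((3 : ℝ) + 1) * n) * Real.exp (δ * (4 * n)) * Real.exp (δ * 1)) δ := by
  have h := biLoc_recentre (biLoc_nFcol κ u hr hδ) hδ u u
  rwa [sub_self, l1_zero, zero_add, add_sub_cancel_left, l1_unitVec] at h

omit [NeZero p] in
/-- [folklore] **THE COMB-FP WORDS ARE PERIOD-COVARIANT** (period `n·p`, a multiple of the block side): `nFcol κ (u + (n·p)·m) = shiftK (−(n·p)·m) (nFcol κ u)`
(block-translation covariance of the comb gauge functions, `bmGaugeAt_shift` + `shift_delta1`). -/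
theorem nFcol_imageShift (κ : Fin 4) (u m : Fin 4 → ℤ) :
    nFcol r n κ (imageShift (n * p) u m) = shiftK (-(((n * p : ℕ) : ℤ) • m)) (nFcol r n κ u) := by
  funext x y a b
  simp only [shiftK, nFcol_apply]
  have hx : x + -(((n * p : ℕ) : ℤ) • m) + (n : ℤ) • ((p : ℤ) • m) = x := by
    rw [Nat.cast_mul, ← smul_smul, neg_add_cancel_right]
  rw [imageShift_mul_eq_add, ← hx, bmGaugeAt_shift _ (NeZero.one_le (n := n)), hx,
    show delta1 κ (u + (n : ℤ) • ((p : ℤ) • m)) = delta1 κ (u + (n : ℤ) • ((p : ℤ) • m)) from rfl, shift_delta1]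
  congr 1
  have e : y = u + (n : ℤ) • ((p : ℤ) • m) + unitVec κ ↔ y + -(((n * p : ℕ) : ℤ) • m) = u + unitVec κ := by
    rw [Nat.cast_mul, ← smul_smul]
    constructor
    · intro h; rw [h]; abel
    · intro h; rw [← sub_eq_add_neg, sub_eq_iff_eq_add] at h; rw [h]; abel
  simp only [e]

end Helpers

/-! ### The `perT` readings of FILE 1 at `d = 3`, scalar fibre -/

section PerT

variable {m : ℕ} (p : ℕ) [NeZero p] {w w' : Fin 4 → (Fin 4 → ℤ) → ℝ} {S : Fin 4 → (Fin 4 → ℤ) → MKer 4 Unit} {C C' Cs δ : ℝ} {P P' : Fin 4 → ℤ}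
  {r r' : I 3 (m + 1) p → ℝ}

/-- [folklore] **FIRST ORDER IN `perT` CURRENCY**: `Σ_k r k • perT s (arr s (S κ′_k ŵ_k)) = perT s (arr s (Σ_κ wsum (w κ) (S κ)))` for responses
`r k = Σ'_m w κ′_k (ŵ_k + s·m)` (FILE 1 `periodiseF_toF_arr_dirsum_wsum`, re-indexed by `(·, ())`). -/
theorem sum_smul_perT_arr (hw : ∀ κ u, |w κ u| ≤ C * Real.exp (-δ * l1 (u - P))) (hS : ∀ κ u, BiLoc (S κ u) u u Cs δ)
    (hScov : ∀ κ u t, S κ (imageShift ((m + 1) * p) u t) = shiftK (-((((m + 1) * p : ℕ) : ℤ) • t)) (S κ u)) (hδ : 0 < δ) (hC : 0 ≤ C)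
    (hr : ∀ k, r k = ∑' t : Fin 4 → ℤ, w k.2.2 (imageShift ((m + 1) * p) (windowMap 4 ((m + 1) * p) (torusBlockEquiv (m + 1) p (k.1, k.2.1))) t)) :
    ∑ k : I 3 (m + 1) p, r k • perT ((m + 1) * p) (arr ((m + 1) * p) (S k.2.2 (windowMap 4 ((m + 1) * p) (torusBlockEquiv (m + 1) p (k.1, k.2.1)))))
      = perT ((m + 1) * p) (arr ((m + 1) * p) (fun x y a b => ∑ κ : Fin 4, wsum (w κ) (S κ) x y a b)) := by
  simp only [perT, hr]
  rw [periodiseF_toF_arr_dirsum_wsum (d := 3) hw hS hScov hδ hC, submatrix_sum_smul]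

/-- [folklore] **DIAGONAL SECOND ORDER IN `perT` CURRENCY**: `Σ_k (r k·r′ k) • perT s (arr s (S κ′_k ŵ_k)) = perT s (arr s (Σ_κ wsum (w κ) (u ↦ w′_perˢ κ u · S κ u)))`
(FILE 1 `periodiseF_toF_arr_dirsum_wsum_per`). -/
theorem sum_smul_perT_arr_per (hw : ∀ κ u, |w κ u| ≤ C * Real.exp (-δ * l1 (u - P))) (hw' : ∀ κ u, |w' κ u| ≤ C' * Real.exp (-δ * l1 (u - P')))
    (hS : ∀ κ u, BiLoc (S κ u) u u Cs δ)
    (hScov : ∀ κ u t, S κ (imageShift ((m + 1) * p) u t) = shiftK (-((((m + 1) * p : ℕ) : ℤ) • t)) (S κ u)) (hδ : 0 < δ) (hC : 0 ≤ C)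
    (hr : ∀ k, r k = ∑' t : Fin 4 → ℤ, w k.2.2 (imageShift ((m + 1) * p) (windowMap 4 ((m + 1) * p) (torusBlockEquiv (m + 1) p (k.1, k.2.1))) t))
    (hr' : ∀ k, r' k = ∑' t : Fin 4 → ℤ, w' k.2.2 (imageShift ((m + 1) * p) (windowMap 4 ((m + 1) * p) (torusBlockEquiv (m + 1) p (k.1, k.2.1))) t)) :
    ∑ k : I 3 (m + 1) p, (r k * r' k) • perT ((m + 1) * p) (arr ((m + 1) * p) (S k.2.2 (windowMap 4 ((m + 1) * p) (torusBlockEquiv (m + 1) p (k.1, k.2.1)))))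
      = perT ((m + 1) * p) (arr ((m + 1) * p) (fun x y a b => ∑ κ : Fin 4,
          wsum (w κ) (fun u => fun x y a b => (∑' t : Fin 4 → ℤ, w' κ (imageShift ((m + 1) * p) u t)) * S κ u x y a b) x y a b)) := by
  simp only [perT, hr, hr']
  rw [periodiseF_toF_arr_dirsum_wsum_per (d := 3) hw hw' hS hScov hδ hC, submatrix_sum_smul]

end PerT

/-! ## §2 «FP-PACKED»: the comb-FP slot at response-packed gauge jets -/

section CombFP

variable (m : ℕ) (p : ℕ) [NeZero p] {r : Fin 4 → ℕ}

/-- [folklore] **«FP-PACKED» — THE COMB-FP TOWER SLOT AT RESPONSE-PACKED GAUGE JETS IS A ONE-LOOP FUNCTIONAL OF THE IDENTITY LEG AGAINST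
PERIODISED ARRAYS OF THE PACKED COMB WORDS.**  On the torus `Site 4 ((m+1)·p)` (root `r ∈ box 4 (m+1)`), for decaying direction-indexed weights `wₛ`
(centre `Pₛ`), `wₜ` (centre `Pₜ`), torus responses `rₛ k = Σ'_m wₛ κ′_k (ŵ_k + s·m)`, `rₜ`, and THE CONVENTION's gauge jets PACKED by them —
`Wₛ = Σ_k rₛ k • (Ê_{e₁ k}·N̂)`, `Wₜ = Σ_l rₜ l • (Ê_{e₁ l}·N̂)`, `Wₛₜ = Σ_k Σ_l (rₛ k·rₜ l) • [k = l]•(Ê_{e₁ k}·N̂)` (in sorted currency):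
`hessT (1; τ_T Wₛ, τ_T Wₜ, τ_T Wₛₜ) = hessT ((idK1)^; (arr s 𝒳₁[wₛ])^, (arr s 𝒳₁[wₜ])^, (arr s 𝒳₂ˢ[wₛ,wₜ])^)`,
`𝒳₁[w] := Σ_κ wsum (w κ) (nFcol κ)`, `𝒳₂ˢ[wₛ,wₜ] := Σ_κ wsum (wₛ κ) (u ↦ (Σ'_m wₜ κ (u + s·m)) · nFcol κ u)` — the second word with ONE weight PERIODISED
(`KCombineCovCombLeg.hessT_combFP_What0_eq_idK1` at `M• :=` the packed jets, `CombFPWordArrays.NhatF_sub_mul_Djet_sub_eq_arr` per bond, FILE 1). -/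
theorem hessT_combFP_packed_eq_arr (hr : r ∈ box (3 + 1) (m + 1))
    (wS wT : Fin 4 → (Fin 4 → ℤ) → ℝ) {CS CT δ : ℝ} {PS PT : Fin 4 → ℤ}
    (hwS : ∀ κ u, |wS κ u| ≤ CS * Real.exp (-δ * l1 (u - PS))) (hwT : ∀ κ u, |wT κ u| ≤ CT * Real.exp (-δ * l1 (u - PT))) (hδ : 0 < δ)
    (rS rT : I 3 (m + 1) p → ℝ)
    (hrS : ∀ k, rS k = ∑' t : Fin 4 → ℤ, wS k.2.2 (imageShift ((m + 1) * p) (windowMap 4 ((m + 1) * p) (torusBlockEquiv (m + 1) p (k.1, k.2.1))) t))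
    (hrT : ∀ k, rT k = ∑' t : Fin 4 → ℤ, wT k.2.2 (imageShift ((m + 1) * p) (windowMap 4 ((m + 1) * p) (torusBlockEquiv (m + 1) p (k.1, k.2.1))) t))
    {Wₛ Wₜ Wₛₜ : Matrix (I 3 (m + 1) p) (CombRows (toSite r) (m + 1) p) ℝ}
    (hWₛ : Wₛ = ∑ k : I 3 (m + 1) p, rS k • ((Djet ((m + 1) * p) (e₁ (m + 1) p k)).submatrix (e₁ (m + 1) p) id * Nhat r (m + 1) p))
    (hWₜ : Wₜ = ∑ k : I 3 (m + 1) p, rT k • ((Djet ((m + 1) * p) (e₁ (m + 1) p k)).submatrix (e₁ (m + 1) p) id * Nhat r (m + 1) p))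
    (hWₛₜ : Wₛₜ = ∑ k : I 3 (m + 1) p, ∑ l : I 3 (m + 1) p, (rS k * rT l) •
      (if k = l then (Djet ((m + 1) * p) (e₁ (m + 1) p k)).submatrix (e₁ (m + 1) p) id * Nhat r (m + 1) p else 0)) :
    hessT (1 : Matrix (CombRows (toSite r) (m + 1) p) (CombRows (toSite r) (m + 1) p) ℝ)
        (tauT (toSite r) (m + 1) p * Wₛ) (tauT (toSite r) (m + 1) p * Wₜ) (tauT (toSite r) (m + 1) p * Wₛₜ)
      = hessT (Matrix.of (periodiseF ((m + 1) * p) (toF idK1)))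
          (Matrix.of (periodiseF ((m + 1) * p) (toF (arr ((m + 1) * p) (fun x y a b => ∑ κ : Fin 4, wsum (wS κ) (nFcol r (m + 1) κ) x y a b)))))
          (Matrix.of (periodiseF ((m + 1) * p) (toF (arr ((m + 1) * p) (fun x y a b => ∑ κ : Fin 4, wsum (wT κ) (nFcol r (m + 1) κ) x y a b)))))
          (Matrix.of (periodiseF ((m + 1) * p) (toF (arr ((m + 1) * p) (fun x y a b => ∑ κ : Fin 4,
            wsum (wS κ) (fun u => fun x y a b => (∑' t : Fin 4 → ℤ, wT κ (imageShift ((m + 1) * p) u t)) * nFcol r (m + 1) κ u x y a b)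
              x y a b))))) := by
  have hCS : 0 ≤ CS := PeriodicArrayWrapLimit.const_nonneg_of_weight (hwS 0)
  have hδ1 : (0 : ℝ) ≤ δ := hδ.le
  -- the packed gauge jets are `M• * N̂` with packed bond selectors `M•`
  have hWₛ' : Wₛ = (∑ k : I 3 (m + 1) p, rS k • (Djet ((m + 1) * p) (e₁ (m + 1) p k)).submatrix (e₁ (m + 1) p) id) * Nhat r (m + 1) p := by
    rw [hWₛ, Matrix.sum_mul]; simp only [Matrix.smul_mul]
  have hWₜ' : Wₜ = (∑ k : I 3 (m + 1) p, rT k • (Djet ((m + 1) * p) (e₁ (m + 1) p k)).submatrix (e₁ (m + 1) p) id) * Nhat r (m + 1) p := by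
    rw [hWₜ, Matrix.sum_mul]; simp only [Matrix.smul_mul]
  have hWₛₜ' : Wₛₜ = (∑ k : I 3 (m + 1) p, (rS k * rT k) • (Djet ((m + 1) * p) (e₁ (m + 1) p k)).submatrix (e₁ (m + 1) p) id) * Nhat r (m + 1) p := by
    rw [hWₛₜ, Matrix.sum_mul]
    refine Finset.sum_congr rfl fun k _ => ?_
    simp only [smul_ite, smul_zero, Finset.sum_ite_eq, Finset.mem_univ, if_true, Matrix.smul_mul]
  -- the per-bond torus letter of the comb words, read at the bond of index `k`
  have hbond : ∀ k : I 3 (m + 1) p,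
      ((NhatF r (m + 1) ((m + 1) * p)).submatrix id (e₁ (m + 1) p) * (Djet ((m + 1) * p) (e₁ (m + 1) p k)).submatrix (e₁ (m + 1) p) id).submatrix
          Prod.fst Prod.fst
        = Matrix.of (periodiseF ((m + 1) * p) (toF (arr ((m + 1) * p)
            (nFcol r (m + 1) k.2.2 (windowMap 4 ((m + 1) * p) (torusBlockEquiv (m + 1) p (k.1, k.2.1))))))) := by
    intro k
    rw [e₁_eq_siteOf (m + 1) p k]
    exact NhatF_sub_mul_Djet_sub_eq_arr r (m + 1) k.2.2 _ p hr
  have hS : ∀ κ u, BiLoc (nFcol r (m + 1) κ u) u u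
      (2 * (((3 : ℝ) + 1) * ((m + 1 : ℕ) : ℝ)) * Real.exp (δ * (4 * ((m + 1 : ℕ) : ℝ))) * Real.exp (δ * 1)) δ :=
    fun κ u => biLoc_nFcol_self (m + 1) r hr hδ1 κ u
  have hScov : ∀ κ u t, nFcol r (m + 1) κ (imageShift ((m + 1) * p) u t) = shiftK (-((((m + 1) * p : ℕ) : ℤ) • t)) (nFcol r (m + 1) κ u) :=
    fun κ u t => nFcol_imageShift (m + 1) p r κ u t
  rw [hessT_combFP_What0_eq_idK1 m p hr _ _ _ hWₛ' hWₜ' hWₛₜ']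
  simp only [Matrix.mul_sum, Matrix.mul_smul, submatrix_sum_smul, hbond, hrS, hrT]
  rw [← periodiseF_toF_arr_dirsum_wsum (d := 3) hwS hS hScov hδ hCS,
    ← periodiseF_toF_arr_dirsum_wsum (d := 3) hwT hS hScov hδ (PeriodicArrayWrapLimit.const_nonneg_of_weight (hwT 0)),
    ← periodiseF_toF_arr_dirsum_wsum_per (d := 3) hwS hwT hS hScov hδ hCS]

end CombFP

end Summit.QuantumFields.BalabanUV.Beta.D1BFx.PackedTowerSlots

end
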